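import Summits.ResolutionOfSingularities.ResolutionOfSingularities.Theorems.WeightedInvariantHypersurfaceLocalGameEFT3
import Mathlib.AlgebraicGeometry.Morphisms.Smooth
import HarnessLib

/-!
# (c8) on an AFFINE smooth chart: the scheme-level clause `IotaUpperSemicontinuous` read on `Spec A`
# (door `HypersurfaceCentreConstruction`, stmt-ResolutionOfSingularities-19897, line `local-engine`; bridge for the
# graded / orbit-space form of (c8) in the registrar's ADDENDUM 2 to (o47), 2026-08-27T13:26:12Z)

Topic: `Summits/ResolutionOfSingularities/ResolutionOfSingularities/Theorems`. Helper for the door item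
`HypersurfaceCentreConstruction` (statement `stmt-ResolutionOfSingularities-19897`, route `WeightedInvariant`).  The
clause (c8) `IotaUpperSemicontinuous ι` of `…HypersurfaceLocalGameEFT3` is stated for smooth quasi-compact SCHEMES `Y`
over a field and reads `ι` at the stalks `𝒪_{Y,y}` on germs of a global section.  The e = 2 consumer of the P3 rung
(registrar's ADDENDUM 2 to ORDER (o47)) reads `ι` on graded affine unit charts `W = Spec A` at the localisations
`A_P`, `P` a (homogeneous) prime.  This file is the AFFINE BRIDGE:

* `iota_stalk_Spec_eq` — for an iso-invariant `ι`, a commutative ring `A`, a point `P` of `Spec A` and `f ∈ A`: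
  `ι (𝒪_{Spec A, P}) (germ of f) = ι (A_P) (f/1)` (the stalk is a localisation of `A` at `P`: Mathlib
  `StructureSheaf.IsLocalization.to_stalk`, transported by `IsLocalization.algEquiv`);
* **`isClosed_setOf_le_iota_atPrime`** — for `ι` iso-invariant and upper semicontinuous (clause (c8)) and `A` a SMOOTH
  algebra over a field `k₀` (`Algebra.Smooth k₀ A`): for every `f ∈ A` and every ordinal `α`, the super-level set
  `{P ∈ Spec A | α ≤ ι (A_P) (f/1)}` is closed in `PrimeSpectrum A`;
* `isClosed_setOf_le_iota_atPrime_subtype` — hence closed in every subspace of `Spec A` (e.g. the homogeneous primes of a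
  grading — the «orbit space» of the addendum), by restriction.

Pure transport; no mathematics.  [OURS · L1 W4.3] Replaces the role of NO printed item; NOT a statement of the manuscript
[claim: Hironaka2017, status: under-review]. AI work, weaker than expert review.

## References

* A. Grothendieck, ÉGA I (1960), §1.3 (the structure sheaf of `Spec A`; stalks are the localisations `A_𝔭`). [folklore]
* res-L1-w43-plan-1, ADDENDUM 2 to ORDER (o47), HOME/STATUS 2026-08-27T13:26:12Z (OURS, AI planning).
-/

noncomputable section

open IsLocalRing AlgebraicGeometry CategoryTheory TopologicalSpace

set_option linter.dupNamespace false -- mandated namespace of this single-conjunct summit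

namespace Summit.ResolutionOfSingularities.ResolutionOfSingularities.Cruxes.HypersurfaceCentreConstruction.LocalEngine

variable {ι : (R : Type) → [CommRing R] → R → Ordinal.{0}}

/-- **The stalk reading on `Spec A` is the localisation reading**: for an iso-invariant `ι`,
`ι (𝒪_{Spec A, P}) (germ_P f) = ι (A_P) (f/1)`. [folklore] -/
theorem iota_stalk_Spec_eq (hι : IotaIsoInvariant ι) (A : Type) [CommRing A] (P : ↥(Spec (CommRingCat.of A)))
    (f : A) :
    ι ((Spec (CommRingCat.of A)).presheaf.stalk P)
        ((Spec (CommRingCat.of A)).presheaf.germ ⊤ P trivial ((Scheme.ΓSpecIso (CommRingCat.of A)).inv f)) =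
      ι (Localization.AtPrime P.asIdeal) (algebraMap A (Localization.AtPrime P.asIdeal) f) := by
  -- the stalk is the structure-sheaf stalk, a localisation of `A` at `P`
  let Sₚ : Type := (Spec.structureSheaf A).presheaf.stalk P
  haveI : IsLocalization.AtPrime Sₚ P.asIdeal := StructureSheaf.IsLocalization.to_stalk A P
  let e : Sₚ ≃ₐ[A] Localization.AtPrime P.asIdeal :=
    IsLocalization.algEquiv P.asIdeal.primeCompl Sₚ (Localization.AtPrime P.asIdeal)
  -- the germ of the global section `f` is `toStalk f = algebraMap A Sₚ f`
  have hgerm : (Spec (CommRingCat.of A)).presheaf.germ ⊤ P trivial ((Scheme.ΓSpecIso (CommRingCat.of A)).inv f) =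
      (algebraMap A Sₚ f : Sₚ) := by
    rw [StructureSheaf.stalkAlgebra_map, Scheme.ΓSpecIso_inv]
    exact StructureSheaf.algebraMap_germ_apply (R := A) ⊤ P trivial f
  have key : ι Sₚ (algebraMap A Sₚ f) = ι (Localization.AtPrime P.asIdeal) (algebraMap A _ f) := by
    have h := hι Sₚ (Localization.AtPrime P.asIdeal) (e : Sₚ ≃+* Localization.AtPrime P.asIdeal) (algebraMap A Sₚ f)
    rw [AlgEquiv.coe_ringEquiv, AlgEquiv.commutes] at h
    exact h.symm
  rw [← key]
  exact congrArg (ι Sₚ) hgerm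

/-- **(c8) read on an affine smooth chart**: for `ι` iso-invariant and upper semicontinuous and `A` smooth over a field
`k₀`, every super-level set `{P | α ≤ ι (A_P) (f/1)}` is closed in `Spec A`. [OURS · L1 W4.3 · affine bridge for (c8)] -/
theorem isClosed_setOf_le_iota_atPrime (hι : IotaIsoInvariant ι) (h8 : IotaUpperSemicontinuous ι) (k₀ : Type) [Field k₀]
    (A : Type) [CommRing A] [Algebra k₀ A] [Algebra.Smooth k₀ A] (f : A) (α : Ordinal.{0}) :
    IsClosed {P : PrimeSpectrum A | α ≤ ι (Localization.AtPrime P.asIdeal) (algebraMap A _ f)} := by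
  let Y : Scheme.{0} := Spec (CommRingCat.of A)
  let hY : Y ⟶ Spec (CommRingCat.of k₀) := Spec.map (CommRingCat.ofHom (algebraMap k₀ A))
  haveI : Smooth hY := by
    refine (HasRingHomProperty.Spec_iff (P := @Smooth)).mpr ?_
    rw [CommRingCat.hom_ofHom]
    exact RingHom.smooth_algebraMap.mpr ‹Algebra.Smooth k₀ A›
  have h := h8 k₀ Y hY ((Scheme.ΓSpecIso (CommRingCat.of A)).inv f) α
  have key : ∀ P : ↥Y, (α ≤ ι (Y.presheaf.stalk P) (Y.presheaf.germ ⊤ P trivial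
      ((Scheme.ΓSpecIso (CommRingCat.of A)).inv f))) ↔
      (α ≤ ι (Localization.AtPrime P.asIdeal) (algebraMap A (Localization.AtPrime P.asIdeal) f)) := fun P => by
    rw [iota_stalk_Spec_eq hι A P f]
  have hset : {y : ↥Y | α ≤ ι (Y.presheaf.stalk y) (Y.presheaf.germ ⊤ y trivial
      ((Scheme.ΓSpecIso (CommRingCat.of A)).inv f))} =
      {P : ↥Y | α ≤ ι (Localization.AtPrime P.asIdeal) (algebraMap A (Localization.AtPrime P.asIdeal) f)} :=
    Set.ext key
  rw [hset] at h
  exact h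

/-- **Restriction to a subspace** (e.g. the homogeneous primes of a grading = the orbit space): the super-level sets stay
closed in every subtype of `Spec A`. [folklore] -/
theorem isClosed_setOf_le_iota_atPrime_subtype (hι : IotaIsoInvariant ι) (h8 : IotaUpperSemicontinuous ι) (k₀ : Type)
    [Field k₀] (A : Type) [CommRing A] [Algebra k₀ A] [Algebra.Smooth k₀ A] (H : Set (PrimeSpectrum A)) (f : A)
    (α : Ordinal.{0}) :
    IsClosed {P : H | α ≤ ι (Localization.AtPrime P.1.asIdeal) (algebraMap A _ f)} :=
  (isClosed_setOf_le_iota_atPrime hι h8 k₀ A f α).preimage continuous_subtype_val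

end Summit.ResolutionOfSingularities.ResolutionOfSingularities.Cruxes.HypersurfaceCentreConstruction.LocalEngine

end
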